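import Literature.Probability.RandomPlanarGeometry.DrivingFunctionMeasurable
import Literature.Probability.RandomPlanarGeometry.SLEBubblesThm65Kappa
import HarnessLib

/-!
# The compensator weight is a measurable function of the SLE curve class on the avoidance event
(line `boundary-area-law`, RS5 law-level part L2)

Line `boundary-area-law` of the crux `SubseqIdentification` (stmt-CriticalPhenomena-0783, route
`SAWRenewalTightness`), restriction reshape r-c4-7 (lead c4). The glue
`sleRestrictionRigidityBelow_of_lawParts` (Theorems/…RigidityOfLawParts.lean) consumes, as its
hypothesis (L2), a factorisation of the compensator weight of [LSW] Thm. 6.5,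

  `X_A(ω) = 𝒫(λ_κ ∫₀^∞ m(A_t − W_t) dt)`,
  `𝒫 = poissonAvoidance`, `λ_κ = sleBubbleIntensity κ`, `m = starBubbleMass`, `A_t − W_t = Loewner.slidHull W A t`,
  `W = sleDriving κ ω`,

through the SLE curve class `Γ ω`: `X_A ω = G (Γ ω)` for a MEASURABLE `G : CurveClass ℂ → [0, ∞]`,
almost surely on the samples `ω` at which `Γ ω` is the compactified `φ`-image of the trace generated by
`sleDriving κ ω`. This file PROVES that factorisation **on the avoidance event `{γ ∩ A = ∅}`** (where the
glue uses it), for `0 < κ ≤ 4`: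

* `compensatorFactorsThroughCurve_of_forall_disjoint_closedHull` — deterministic form: one measurable
  `G` with `X_A ω = G (Γ ω)` for EVERY described sample `ω` whose closed Loewner hulls never meet `A`;
* `compensatorFactorsThroughCurve_of_disjoint` (registered, explicit binders) — the a.e. form on
  `{ω | range (sleTrace κ ω) ∩ A = ∅}`, `κ ≤ 4` (a.s. the hulls of the simple SLE_κ curve miss `A` at all
  times iff the trace misses `A`, `ae_disjoint_closedHull_iff_lt_firstHit`).

Construction. `G := 𝒫(λ_κ · ⨆ₙ ∫⁻_{(0,n]} 𝟙{alive at s} m(A_s − W_s(c)) ds)` with `W(c) = drivingFunction φ c`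
the Loewner transform of the class (`LoewnerDescription.lean`), read as the path `W(c)/√κ ∈ C([0,∞), ℝ)`
so that the integrand is the path functional `MFnK κ A` of `SLERestrictionCompensatorKappa.lean`.
Measurability: `c ↦ W(c)` is Borel (`measurable_drivingFunction_apply`, Lusin–Souslin), the path is a
Borel element of `C([0,∞), ℝ)` (`PathOps.measurable_of_eval`), and `(υ, s) ↦ MFnK κ A s υ` is JOINTLY
measurable (`measurable_MFnK_prod`: measurable in the path at fixed time, `measurable_MFnK`, and
right-continuous in time for every path, `continuousWithinAt_MFnK`, hence the limit of its dyadic upper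
discretisations — Karatzas–Shreve Prop. 1.1.13), so the truncated compensators are measurable by Tonelli
(`measurable_lintegral_MFnK`). Identification: for a described sample the driving function of `Γ ω` IS
`sleDriving κ ω` (uniqueness of the Loewner transform, `IsLoewnerDescribed.driving_unique_holds`), the path
is the Brownian path `brownianCPath ω`, and on an all-time-alive sample
`∫⁻ m(A_t − W_t) d(timeMeasure) = ⨆_t LpK κ A t ω` (`lintegral_timeMeasure_eq_iSup_LpK`).

Why only on the avoidance event (note for the line lead). Off `{γ ∩ A = ∅}` the set
`Loewner.slidHull W A t` past the hitting time is built from the documented junk value `g_t z = z` of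
`Loewner.map` at swallowed / visited points, and `starBubbleMass` of that set is `0` off `𝒬*` but is the
genuine positive mass whenever the junk set happens to be a `*`-hull (e.g. a driver whose simple trace
traverses all of an arc-like `A`: then `slidHull W A t = A − W_t ∈ 𝒬*` for large `t`). A GLOBAL measurable
factorisation would therefore require deciding `IsStarHull (slidHull W A t)` measurably in `(W, t)` (simple
connectivity of a driver-dependent planar set) or an almost-sure prime-end analysis of `g_t` at slit points —
neither is in the tree; the glue only ever uses the factorisation on the avoidance event.

References: G. F. Lawler, O. Schramm, W. Werner, *Conformal restriction: the chordal case*, J. Amer.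
Math. Soc. 16 (2003), Prop. 5.3, Thm. 6.5 (the compensator); G. F. Lawler, *Conformally Invariant
Processes in the Plane* (2005), §4.1 (Loewner transform); I. Karatzas, S. Shreve, *Brownian Motion and
Stochastic Calculus* (1991), Prop. 1.1.13. No named fact is used.
-/

noncomputable section

open MeasureTheory Filter Topology Set
open scoped NNReal ENNReal
open Literature.Probability.RandomPlanarGeometry
open Literature.Probability.Process (preWienerMeasure dyadicCeil lt_dyadicCeil tendsto_dyadicCeil)
open UpperHalfPlane (upperHalfPlaneSet)

namespace Summit.CriticalPhenomena.SAWScalingLimit.Theorems.SubseqIdentification.BoundaryAreaLaw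

open Loewner PathOps

/-! ### Measurability of the ingredients -/

/-- `𝒫 : m ↦ e^{−m}` (with `e^{−∞} = 0`) is Borel measurable on `[0, ∞]`. [folklore] -/
theorem measurable_poissonAvoidance : Measurable poissonAvoidance := by
  unfold poissonAvoidance
  refine Measurable.ite ?_ measurable_const ?_
  · exact measurableSet_singleton _
  · exact ENNReal.measurable_ofReal.comp (Real.measurable_exp.comp ENNReal.measurable_toReal.neg)

section PathSpace

variable [MeasurableSpace C(ℝ≥0, ℝ)] [BorelSpace C(ℝ≥0, ℝ)] {κ : ℝ≥0} {A : Set ℂ}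

/-- **Joint measurability of the mass functional** `(υ, r) ↦ 𝟙{alive at r} · m(A_r − W_r)` on
path space × time: it is measurable in the path at each fixed time (`measurable_MFnK`) and
right-continuous in time for every path (`continuousWithinAt_MFnK`), hence the pointwise limit of its
dyadic upper discretisations `(υ, r) ↦ MFnK κ A ((⌊2ⁿr⌋ + 1) 2⁻ⁿ) υ`, each of which factors measurably
through the countable product `C([0,∞), ℝ) × ℕ` (Karatzas–Shreve 1991, Prop. 1.1.13). [folklore] -/
theorem measurable_MFnK_prod (hA : IsStarHull A) (hne : A.Nonempty) :
    Measurable fun p : C(ℝ≥0, ℝ) × ℝ≥0 ↦ MFnK κ A p.2 p.1 := by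
  have hn : ∀ n : ℕ, Measurable fun p : C(ℝ≥0, ℝ) × ℝ≥0 ↦ MFnK κ A (dyadicCeil n p.2) p.1 := by
    intro n
    have hΨ : Measurable fun q : C(ℝ≥0, ℝ) × ℕ ↦ MFnK κ A ((q.2 : ℝ≥0) / 2 ^ n) q.1 := by
      refine measurable_from_prod_countable_left fun k ↦ ?_
      show Measurable fun υ : C(ℝ≥0, ℝ) ↦ MFnK κ A ((k : ℝ≥0) / 2 ^ n) υ
      exact measurable_MFnK hA hne _
    have hΦ : Measurable fun p : C(ℝ≥0, ℝ) × ℝ≥0 ↦ (p.1, ⌊p.2 * 2 ^ n⌋₊ + 1) :=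
      measurable_fst.prodMk ((measurable_snd.mul_const _).nat_floor.add_const 1)
    have heq : (fun p : C(ℝ≥0, ℝ) × ℝ≥0 ↦ MFnK κ A (dyadicCeil n p.2) p.1) =
        (fun q : C(ℝ≥0, ℝ) × ℕ ↦ MFnK κ A ((q.2 : ℝ≥0) / 2 ^ n) q.1) ∘
          fun p : C(ℝ≥0, ℝ) × ℝ≥0 ↦ (p.1, ⌊p.2 * 2 ^ n⌋₊ + 1) := by
      funext p
      simp only [Function.comp_apply, dyadicCeil]
    rw [heq]
    exact hΨ.comp hΦ
  refine measurable_of_tendsto_metrizable hn (tendsto_pi_nhds.2 fun p ↦ ?_)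
  have h2 : Tendsto (fun n ↦ dyadicCeil n p.2) atTop (𝓝[Ici p.2] p.2) :=
    tendsto_nhdsWithin_of_tendsto_nhds_of_eventually_within _ (tendsto_dyadicCeil p.2)
      (Eventually.of_forall fun n ↦ (lt_dyadicCeil n p.2).le)
  exact (continuousWithinAt_MFnK hA hne p.1 p.2).tendsto.comp h2

/-- **The truncated compensator `∫⁻_{(0,T]} 𝟙{alive at s} m(A_s − W_s) ds` is a measurable functional of
the path** (Tonelli, from the joint measurability `measurable_MFnK_prod`).
[cite: LawlerSchrammWerner2003Restriction, Prop. 5.3 (the compensator ∫ Sh_s(W_s)/6 ds)] -/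
theorem measurable_lintegral_MFnK (hA : IsStarHull A) (hne : A.Nonempty) (T : ℝ) :
    Measurable fun υ : C(ℝ≥0, ℝ) ↦ ∫⁻ s in Ioc (0 : ℝ) T, ENNReal.ofReal (MFnK κ A s.toNNReal υ) := by
  have h : Measurable fun p : C(ℝ≥0, ℝ) × ℝ ↦ ENNReal.ofReal (MFnK κ A p.2.toNNReal p.1) :=
    ((measurable_MFnK_prod hA hne).comp (measurable_fst.prodMk measurable_snd.real_toNNReal)).ennreal_ofReal
  exact h.lintegral_prod_right'

end PathSpace

/-! ### The factorisation on the avoidance event -/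

section Factor

open scoped PathBorel

/-- **The compensator weight factors measurably through the curve class on all-time-alive described
samples (deterministic form).** For `κ > 0`, a chordal uniformizing map `φ` of `(D; a, b)` and `A ∈ 𝒬*`
there is a measurable `G : CurveClass ℂ → [0, ∞]` such that for every `Γ` and EVERY sample `ω` at which
`Γ ω` is the compactified `φ`-image of the curve generating the chain of `sleDriving κ ω`, and whose closed
hulls never meet `A`, `𝒫(λ_κ ∫ m(A_t − W_t) dt) = G (Γ ω)`. (`G = 𝒫(λ_κ ⨆ₙ ∫⁻_{(0,n]} MFnK κ A · (W(c)/√κ))`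
with `W(c) = drivingFunction φ c`; the driving function of a described class is the SLE driver,
`IsLoewnerDescribed.driving_unique_holds`.) [cite: LawlerSchrammWerner2003Restriction, Prop. 5.3 and Thm. 6.5]
[cite: Lawler2005, §4.1 (Loewner transform)] -/
theorem compensatorFactorsThroughCurve_of_forall_disjoint_closedHull {κ : ℝ≥0} (hκ : 0 < κ)
    {D : DobrushinDomain} {φ : ConformalEquiv upperHalfPlaneSet D.carrier} (hφ : D.IsChordalUniformizing φ)
    {A : Set ℂ} (hA : IsStarHull A) :
    ∃ G : CurveClass ℂ → ℝ≥0∞, Measurable G ∧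
      ∀ (Γ : (ℝ≥0 → ℝ) → CurveClass ℂ) (ω : ℝ≥0 → ℝ),
        (Loewner.IsGeneratedByCurve (sleDriving κ ω) (sleTrace κ ω) ∧
          ∃ c : Curve ℂ, Γ ω = CurveClass.mk c ∧
            IsCompactifiedImage φ.boundaryExtension (sleTrace κ ω) (D.pt 1) c) →
        (∀ t, Disjoint (Loewner.closedHull (sleDriving κ ω) t) A) →
        poissonAvoidance (sleBubbleIntensity κ *
            ∫⁻ t, ENNReal.ofReal (starBubbleMass (Loewner.slidHull (sleDriving κ ω) A t)) ∂timeMeasure) =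
          G (Γ ω) := by
  rcases A.eq_empty_or_nonempty with rfl | hne
  · refine ⟨fun _ ↦ 1, measurable_const, fun Γ ω _ _ ↦ ?_⟩
    simp [starBubbleMass_empty]
  -- the path `W(c)/√κ` read off the curve class
  set pth : CurveClass ℂ → C(ℝ≥0, ℝ) := fun c ↦
    ⟨fun r ↦ drivingFunction φ c r / Real.sqrt κ, (continuous_drivingFunction φ c).div_const _⟩ with hpth
  have hpm : Measurable pth :=
    PathOps.measurable_of_eval fun r ↦ (measurable_drivingFunction_apply hφ r).div_const _
  have h1 : Measurable fun c ↦ ⨆ n : ℕ,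
      ∫⁻ s in Ioc (0 : ℝ) ((n : ℝ≥0) : ℝ), ENNReal.ofReal (MFnK κ A s.toNNReal (pth c)) :=
    Measurable.iSup fun n ↦ (measurable_lintegral_MFnK hA hne _).comp hpm
  refine ⟨fun c ↦ poissonAvoidance (sleBubbleIntensity κ *
      ⨆ n : ℕ, ∫⁻ s in Ioc (0 : ℝ) ((n : ℝ≥0) : ℝ), ENNReal.ofReal (MFnK κ A s.toNNReal (pth c))),
    measurable_poissonAvoidance.comp (h1.const_mul _), ?_⟩
  rintro Γ ω ⟨hgen, c, hc, hI⟩ hall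
  have hdesc : IsLoewnerDescribed φ (Γ ω) (sleDriving κ ω) :=
    ⟨continuous_sleDriving κ ω, sleTrace κ ω, hgen, c, hc, hI⟩
  have hW : drivingFunction φ (Γ ω) = sleDriving κ ω :=
    IsLoewnerDescribed.drivingFunction_eq IsLoewnerDescribed.driving_unique_holds hφ hdesc
  have hsq : Real.sqrt κ ≠ 0 := (Real.sqrt_pos.2 (by exact_mod_cast hκ)).ne'
  have hpω : pth (Γ ω) = brownianCPath ω := by
    ext r
    simp only [hpth, ContinuousMap.coe_mk, hW, sleDriving_apply, brownianCPath_apply]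
    exact mul_div_cancel_left₀ _ hsq
  have hall' : ∀ t, Disjoint (closedHull (drvK κ (brownianCPath ω)) t) A := fun t ↦ by
    rw [drvK_brownianCPath]; exact hall t
  show _ = poissonAvoidance (sleBubbleIntensity κ *
    ⨆ n : ℕ, ∫⁻ s in Ioc (0 : ℝ) ((n : ℝ≥0) : ℝ), ENNReal.ofReal (MFnK κ A s.toNNReal (pth (Γ ω))))
  rw [hpω, lintegral_timeMeasure_eq_iSup_LpK hA hne hall', iSup_eq_iSup_nat_of_monotone (LpK_mono ω)]
  rfl

/-- **L2 on the avoidance event (registered form, explicit binders).** For `0 < κ ≤ 4`, a chordal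
uniformizing map `φ` of `(D; a, b)` and `A ∈ 𝒬*` there is a measurable `G : CurveClass ℂ → [0, ∞]` such
that for every `Γ`, almost surely, if `Γ ω` is the compactified `φ`-image of the curve generating the chain
of `sleDriving κ ω` and the trace misses `A`, then `𝒫(λ_κ ∫ m(A_t − W_t) dt) = G (Γ ω)` (for `κ ≤ 4` the
closed hulls of the a.s. simple curve miss `A` at all times iff the trace does,
`ae_disjoint_closedHull_iff_lt_firstHit`). [cite: LawlerSchrammWerner2003Restriction, Prop. 5.3 and Thm. 6.5] -/
theorem compensatorFactorsThroughCurve_of_disjoint :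
    ∀ (κ : ℝ≥0), 0 < κ → κ ≤ 4 → ∀ (D : DobrushinDomain) (φ : ConformalEquiv upperHalfPlaneSet D.carrier),
      D.IsChordalUniformizing φ → ∀ (A : Set ℂ), IsStarHull A →
        ∃ G : CurveClass ℂ → ℝ≥0∞, Measurable G ∧
          ∀ (Γ : (ℝ≥0 → ℝ) → CurveClass ℂ), ∀ᵐ ω ∂preWienerMeasure,
            (Loewner.IsGeneratedByCurve (sleDriving κ ω) (sleTrace κ ω) ∧
              ∃ c : Curve ℂ, Γ ω = CurveClass.mk c ∧
                IsCompactifiedImage φ.boundaryExtension (sleTrace κ ω) (D.pt 1) c) →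
            Disjoint (range (sleTrace κ ω)) A →
            poissonAvoidance (sleBubbleIntensity κ *
                ∫⁻ t, ENNReal.ofReal (starBubbleMass (Loewner.slidHull (sleDriving κ ω) A t)) ∂timeMeasure) =
              G (Γ ω) := by
  intro κ hκ hκ4 D φ hφ A hA
  obtain ⟨G, hGm, hG⟩ := compensatorFactorsThroughCurve_of_forall_disjoint_closedHull hκ hφ hA
  refine ⟨G, hGm, fun Γ ↦ ?_⟩
  filter_upwards [ae_disjoint_closedHull_iff_lt_firstHit hκ hκ4 hA] with ω hω hhyp hdisj
  refine hG Γ ω hhyp fun t ↦ ?_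
  have hT : firstHit (sleTrace κ ω) A = ⊤ := firstHit_eq_top_iff_disjoint.2 hdisj
  have ht := (hω t).2 (by rw [hT]; exact WithTop.coe_lt_top t)
  rwa [drvK_brownianCPath] at ht

end Factor

end Summit.CriticalPhenomena.SAWScalingLimit.Theorems.SubseqIdentification.BoundaryAreaLaw

end
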